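import Mathlib
import Literature.AlgebraicGeometry.Tropical.TorusCycles
import Summits.HodgeConjecture.HodgeConjecture.Theorems.TropicalWeilObstructionTropicalHodgeBoundFramePairing
import Summits.HodgeConjecture.HodgeConjecture.Theorems.TropicalWeilObstructionTropicalWeilVanishingSimplexDeterminants
import HarnessLib

/-!
# No effective tropical cycle lifts to `ℝᵍ` (helper toward `stub_rung_flatObstructed`, crux
# `TropicalWeilVanishing`, stmt-HodgeConjecture-18478, line `identity_transfer`)

Route `TropicalWeilObstruction` of `HodgeConjecture`. For an effective tropical `(q+1)`-cycle `Z` on a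
tropical torus `ℝᵍ/Qℤᵍ` in the certificate format of `Literature.AlgebraicGeometry.Tropical.TorusCycles`
(weighted framed lattice simplices; facet slots `(σ, i)` grouped in classes, each facet a reordered
`Q·k_{σ,i}`-translate of the reference simplex of its class; signed frames cancel class by class), the
facet shifts `k_{σ,i} ∈ ℤᵍ` form a `1`-cochain on the incidence structure. **If that cochain is a
coboundary** — `k_{σ,i} - k_{τ,j} = p_σ - p_τ` whenever `(σ,i)`, `(τ,j)` lie in the same class, for some
real potentials `p` on the cells (equivalently: translating cell `σ` by `-Q p_σ` glues all facets
EXACTLY, i.e. the cycle lifts to a compact cycle of `ℝᵍ`) — **then `Z` has no cells** (`no_potentials`).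

Proof = discrete Stokes in one Plücker coordinate `S₀` (chosen with `det L₀[S₀,·] ≠ 0` for the frame
`L₀` of cell `0`, `exists_pluckerCoord_ne_zero`): the positive quantity
`Σ_σ w_σ det L_σ[S₀,·] · det [v_{σ,j+1} - v_{σ,0}]|_{S₀} = Σ_σ w_σ (det L_σ[S₀,·])² det T_σ`
(`det_edges_eq`) is, cell by cell, the alternating sum of the cones over the facets
(`sum_sign_det_succAbove`); by `facet_eq` and `det_add_const` the cone over facet `(σ,i)` is
`sign π_{σ,i} · (cone(R_f) + apex(Q k̄_f)) + apex(Q p_σ)` with `f` its class and `k = k̄_f + p_σ`;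
the class terms die against `balanced` at `S₀` (`sum_slot_eq_sum_class`), the apex terms of `Q p_σ`
over the facets of one cell die by `sum_sign_det_apex_face`. So the positive quantity vanishes —
absurd. This is the combinatorial core of "an effective tropical cycle with non-zero class is not
homologous to a cycle of the universal cover"; the stub uses it to produce a closed incidence chain
with non-zero total shift. Mathlib + tree lemmas only; no definition, no named fact, no sorry.
-/

-- `Summit.HodgeConjecture.HodgeConjecture.…` is the mandated namespace (single-conjunct summit).
set_option linter.dupNamespace false

noncomputable section

open scoped BigOperators Matrix
open Matrix

namespace Summit.HodgeConjecture.HodgeConjecture.Theorems.TropicalWeilVanishing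

open Literature.AlgebraicGeometry.Tropical

variable {g q : ℕ} {Q : Matrix (Fin g) (Fin g) ℝ}

/-- Some Plücker coordinate of a saturated frame is non-zero (Cauchy–Binet with a left inverse). [folklore] -/
theorem exists_pluckerCoord_ne_zero (c : TropicalCell g (q + 1)) :
    ∃ S : Fin (q + 1) → Fin g, pluckerCoord c.frame S ≠ 0 := by
  obtain ⟨Mz, hMz⟩ := c.frame_saturated
  have h := TropicalHodgeBound.sum_det_submatrix_mul_det_submatrix Mz c.frame
  rw [hMz, Matrix.det_one, mul_one] at h
  have hne : ∑ f : Fin (q + 1) → Fin g, (Mz.submatrix id f).det * (c.frame.submatrix f id).det ≠ 0 := by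
    rw [h]; exact_mod_cast (Nat.factorial_pos (q + 1)).ne'
  obtain ⟨S, -, hS⟩ := Finset.exists_ne_zero_of_sum_ne_zero hne
  exact ⟨S, fun h0 => hS (by rw [pluckerCoord] at h0; rw [h0, mul_zero])⟩

/-- The edge matrix of a cell in the coordinates `S`: `det [v_{j+1} - v_0]|_S = det L[S,·] · det T`.
[cite: MikhalkinZharkov2014Eigenwave, Prop. 4.3] -/
theorem det_edges_eq (c : TropicalCell g (q + 1)) (S : Fin (q + 1) → Fin g) :
    (Matrix.of fun j : Fin (q + 1) => (fun a => c.vertex j.succ (S a) - c.vertex 0 (S a))).det =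
      (pluckerCoord c.frame S : ℝ) * c.edgeCoeff.det := by
  have hmat : (Matrix.of fun j : Fin (q + 1) => (fun a => c.vertex j.succ (S a) - c.vertex 0 (S a))) =
      ((c.frame.submatrix S id).map ((↑) : ℤ → ℝ) * c.edgeCoeff)ᵀ := by
    ext j a
    simp [Matrix.mul_apply, c.vertex_succ_sub]
  rw [hmat, Matrix.det_transpose, Matrix.det_mul, pluckerCoord]
  congr 1
  have := (Int.castRingHom ℝ).map_det (c.frame.submatrix S id)
  rw [RingHom.mapMatrix_apply] at this
  exact this.symm

/-- Regrouping a sum over facet slots by facet class. [folklore] -/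
theorem sum_slot_eq_sum_class {N C : ℕ} (cls : Fin N → Fin (q + 2) → Fin C)
    (a : Fin N → Fin (q + 2) → ℝ) (G : Fin C → ℝ) :
    ∑ σ, ∑ i, a σ i * G (cls σ i) = ∑ f, G f * ∑ σ, ∑ i, (if cls σ i = f then a σ i else 0) := by
  have key : ∀ σ i, a σ i * G (cls σ i) =
      ∑ f : Fin C, (if cls σ i = f then a σ i * G f else (0 : ℝ)) := by
    intro σ i
    rw [Finset.sum_ite_eq]
    simp
  calc ∑ σ, ∑ i, a σ i * G (cls σ i)
      = ∑ σ, ∑ i, ∑ f : Fin C, (if cls σ i = f then a σ i * G f else (0 : ℝ)) := by simp_rw [key]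
    _ = ∑ σ, ∑ f : Fin C, ∑ i, (if cls σ i = f then a σ i * G f else (0 : ℝ)) :=
        Finset.sum_congr rfl fun σ _ => Finset.sum_comm
    _ = ∑ f : Fin C, ∑ σ, ∑ i, (if cls σ i = f then a σ i * G f else (0 : ℝ)) := Finset.sum_comm
    _ = ∑ f, G f * ∑ σ, ∑ i, (if cls σ i = f then a σ i else 0) := by
        refine Finset.sum_congr rfl fun f _ => ?_
        rw [Finset.mul_sum]
        refine Finset.sum_congr rfl fun σ _ => ?_
        rw [Finset.mul_sum]
        refine Finset.sum_congr rfl fun i _ => ?_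
        split_ifs <;> ring

/-- **No effective tropical cycle lifts to `ℝᵍ`.** If the facet shifts of an effective tropical
`(q+1)`-cycle on `ℝᵍ/Qℤᵍ` are a coboundary — `k_{σ,i} - k_{τ,j} = p_σ - p_τ` for all facet slots in the
same class, for some (real) potentials `p` on the cells — then the cycle has no cells. Proof (discrete
Stokes): with `S₀` a Plücker coordinate where the frame of cell `0` is non-zero and
`W_σ = w_σ · det L_σ[S₀,·]`, the sum `Σ_σ W_σ · det [v_{σ,j+1} - v_{σ,0}]|_{S₀} = Σ_σ w_σ det L_σ[S₀,·]² det T_σ > 0`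
is rewritten cell by cell as the alternating sum of the cones over the facets (`sum_sign_det_succAbove`);
by `facet_eq` each facet is a reordered translate `R_f + Q k_{σ,i}` of its class's reference simplex,
so its cone is `± (cone(R_f) + apex(Q k̄_f) + apex(Q p_σ))` (`det_add_const`, `k = k̄_f + p_σ`); the
first two depend on the class only and die against `balanced` at `S₀`; the apex terms of `Q p_σ` over
the facets of one cell die by `sum_sign_det_apex_face`. [cite: MikhalkinZharkov2014Eigenwave, Def. 4.2 and Prop. 4.3] -/
theorem no_potentials (Z : TropicalTorusCycle g (q + 1) Q) (h0 : 0 < Z.numCells)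
    (pot : Fin Z.numCells → Fin g → ℝ)
    (hpot : ∀ σ i τ j, Z.facetClass σ i = Z.facetClass τ j →
      (fun a => (Z.facetShift σ i a : ℝ) - (Z.facetShift τ j a : ℝ)) = pot σ - pot τ) : False := by
  classical
  -- a Plücker coordinate where cell `0` is visible
  set σ₀ : Fin Z.numCells := ⟨0, h0⟩ with hσ₀
  obtain ⟨S₀, hS₀⟩ := exists_pluckerCoord_ne_zero (Z.cell σ₀)
  -- class-constant part of the shifts
  let kbar : Fin Z.numFacetClasses → Fin g → ℝ := fun f =>
    if h : ∃ s : Fin Z.numCells × Fin (q + 2), Z.facetClass s.1 s.2 = f then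
      (fun a => (Z.facetShift h.choose.1 h.choose.2 a : ℝ)) - pot h.choose.1 else 0
  have hk : ∀ σ i, (fun a => (Z.facetShift σ i a : ℝ)) = kbar (Z.facetClass σ i) + pot σ := by
    intro σ i
    have hex : ∃ s : Fin Z.numCells × Fin (q + 2), Z.facetClass s.1 s.2 = Z.facetClass σ i := ⟨(σ, i), rfl⟩
    have hdef : kbar (Z.facetClass σ i) =
        (fun a => (Z.facetShift hex.choose.1 hex.choose.2 a : ℝ)) - pot hex.choose.1 := by
      simp only [kbar, dif_pos hex]
    have hrel := hpot hex.choose.1 hex.choose.2 σ i hex.choose_spec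
    rw [hdef]
    ext a
    have := congrFun hrel a
    simp only [Pi.sub_apply, Pi.add_apply] at this ⊢
    linarith
  -- coordinates
  let x : Fin Z.numCells → Fin (q + 2) → Fin (q + 1) → ℝ := fun σ k a => (Z.cell σ).vertex k (S₀ a)
  let r : Fin Z.numFacetClasses → Fin (q + 1) → Fin (q + 1) → ℝ := fun f j a => Z.refFacet f j (S₀ a)
  let cQ : (Fin g → ℝ) → Fin (q + 1) → ℝ := fun v a => (Q *ᵥ v) (S₀ a)
  have hcQ_add : ∀ v v', cQ (v + v') = cQ v + cQ v' := fun v v' => by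
    ext a; simp [cQ, Matrix.mulVec_add]
  -- `facet_eq` in coordinates
  have hfacet : ∀ σ i, (fun j => x σ (i.succAbove (Z.facetPerm σ i j))) =
      fun j => r (Z.facetClass σ i) j + cQ (fun a => (Z.facetShift σ i a : ℝ)) := by
    intro σ i
    ext j a
    simp only [x, r, cQ, Pi.add_apply, Matrix.mulVec, dotProduct]
    exact Z.facet_eq σ i j (S₀ a)
  -- per slot decomposition of the cone over the facet
  let W : Fin Z.numCells → ℝ := fun σ => ((Z.cell σ).weight : ℝ) * (pluckerCoord (Z.cell σ).frame S₀ : ℝ)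
  let G : Fin Z.numFacetClasses → ℝ := fun f =>
    (Matrix.of (r f)).det + (Matrix.of (Fin.cons (cQ (kbar f)) fun j : Fin q => r f j.succ - r f 0 :
      Fin (q + 1) → Fin (q + 1) → ℝ)).det
  let D : Fin Z.numCells → Fin (q + 2) → ℝ := fun σ i =>
    (Matrix.of (Fin.cons (cQ (pot σ)) fun j : Fin q => x σ (i.succAbove j.succ) - x σ (i.succAbove 0) :
      Fin (q + 1) → Fin (q + 1) → ℝ)).det
  have hslot : ∀ σ i, (Matrix.of fun j => x σ (i.succAbove j)).det =
      ((Equiv.Perm.sign (Z.facetPerm σ i) : ℤˣ) : ℤ) * G (Z.facetClass σ i) + D σ i := by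
    intro σ i
    have hsq : (((Equiv.Perm.sign (Z.facetPerm σ i) : ℤˣ) : ℤ) : ℝ) *
        (((Equiv.Perm.sign (Z.facetPerm σ i) : ℤˣ) : ℤ) : ℝ) = 1 := by
      rcases Int.units_eq_one_or (Equiv.Perm.sign (Z.facetPerm σ i)) with h | h <;> simp [h]
    have ha := det_of_perm (fun j => x σ (i.succAbove j)) (Z.facetPerm σ i)
    rw [hfacet σ i, det_add_const, hk σ i, hcQ_add, det_cons_add] at ha
    have he : (fun j : Fin q => r (Z.facetClass σ i) j.succ - r (Z.facetClass σ i) 0) =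
        fun j : Fin q => x σ (i.succAbove (Z.facetPerm σ i j.succ)) -
          x σ (i.succAbove (Z.facetPerm σ i 0)) := by
      have h1 : ∀ j, r (Z.facetClass σ i) j =
          x σ (i.succAbove (Z.facetPerm σ i j)) - cQ (fun a => (Z.facetShift σ i a : ℝ)) := by
        intro j
        have := congrFun (hfacet σ i) j
        rw [this]; abel
      ext j a
      simp only [h1, Pi.sub_apply]
      ring
    have hD : (Matrix.of (Fin.cons (cQ (pot σ)) fun j : Fin q =>
        r (Z.facetClass σ i) j.succ - r (Z.facetClass σ i) 0 : Fin (q + 1) → Fin (q + 1) → ℝ)).det =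
        ((Equiv.Perm.sign (Z.facetPerm σ i) : ℤˣ) : ℤ) * D σ i := by
      rw [he]
      exact det_cons_sub_perm (cQ (pot σ)) (fun j => x σ (i.succAbove j)) (Z.facetPerm σ i)
    rw [hD] at ha
    -- `ha : det r + (det apex(k̄) + sign * D) = sign * det [x ∘ succAbove]`; solve for the latter
    have := congrArg (fun t => (((Equiv.Perm.sign (Z.facetPerm σ i) : ℤˣ) : ℤ) : ℝ) * t) ha
    rw [← mul_assoc, hsq, one_mul] at this
    rw [← this]
    simp only [G]
    linear_combination (D σ i) * hsq
  -- the weighted sum of the volume vectors, two ways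
  have hsum : ∑ σ, W σ * (Matrix.of fun j : Fin (q + 1) => x σ j.succ - x σ 0).det = 0 := by
    have h1 : ∀ σ, (Matrix.of fun j : Fin (q + 1) => x σ j.succ - x σ 0).det =
        ∑ i : Fin (q + 2), (-1) ^ (i : ℕ) * (((Equiv.Perm.sign (Z.facetPerm σ i) : ℤˣ) : ℤ) *
          G (Z.facetClass σ i) + D σ i) := by
      intro σ
      rw [← sum_sign_det_succAbove]
      exact Finset.sum_congr rfl fun i _ => by rw [hslot]
    simp_rw [h1, mul_add, Finset.mul_sum, mul_add, Finset.sum_add_distrib]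
    have h2 : ∀ σ, ∑ i : Fin (q + 2), W σ * ((-1) ^ (i : ℕ) * D σ i) = 0 := by
      intro σ
      have := sum_sign_det_apex_face (cQ (pot σ)) (x σ)
      simp only [D]
      rw [← Finset.mul_sum, this, mul_zero]
    simp only [h2, Finset.sum_const_zero, add_zero]
    have h3 : ∑ σ, ∑ i : Fin (q + 2), W σ * ((-1) ^ (i : ℕ) *
        ((((Equiv.Perm.sign (Z.facetPerm σ i) : ℤˣ) : ℤ) : ℝ) * G (Z.facetClass σ i))) =
        ∑ σ, ∑ i : Fin (q + 2), (W σ * (-1) ^ (i : ℕ) *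
          (((Equiv.Perm.sign (Z.facetPerm σ i) : ℤˣ) : ℤ) : ℝ)) * G (Z.facetClass σ i) := by
      refine Finset.sum_congr rfl fun σ _ => Finset.sum_congr rfl fun i _ => by ring
    rw [h3, sum_slot_eq_sum_class Z.facetClass _ G]
    refine Finset.sum_eq_zero fun f _ => ?_
    have hb := Z.balanced f S₀
    have hb' : ∑ σ, ∑ i : Fin (q + 2), (if Z.facetClass σ i = f then
        W σ * (-1) ^ (i : ℕ) * (((Equiv.Perm.sign (Z.facetPerm σ i) : ℤˣ) : ℤ) : ℝ) else 0) = 0 := by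
      have := congrArg (fun z : ℤ => (z : ℝ)) hb
      push_cast at this
      refine Eq.trans ?_ this
      refine Finset.sum_congr rfl fun σ _ => Finset.sum_congr rfl fun i _ => ?_
      split_ifs with hc
      · simp only [W]; ring
      · rfl
    rw [hb', mul_zero]
  -- but every term is `w_σ det L_σ[S₀]² det T_σ ≥ 0`, and the term of cell `0` is positive
  have hterm : ∀ σ, W σ * (Matrix.of fun j : Fin (q + 1) => x σ j.succ - x σ 0).det =
      ((Z.cell σ).weight : ℝ) * (pluckerCoord (Z.cell σ).frame S₀ : ℝ) ^ 2 * (Z.cell σ).edgeCoeff.det := by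
    intro σ
    have := det_edges_eq (Z.cell σ) S₀
    rw [show (Matrix.of fun j : Fin (q + 1) => x σ j.succ - x σ 0) =
      Matrix.of (fun (j : Fin (q + 1)) (a : Fin (q + 1)) =>
        (Z.cell σ).vertex j.succ (S₀ a) - (Z.cell σ).vertex 0 (S₀ a)) from rfl, this]
    simp only [W]
    ring
  simp_rw [hterm] at hsum
  have hnn : ∀ σ ∈ (Finset.univ : Finset (Fin Z.numCells)),
      0 ≤ ((Z.cell σ).weight : ℝ) * (pluckerCoord (Z.cell σ).frame S₀ : ℝ) ^ 2 * (Z.cell σ).edgeCoeff.det :=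
    fun σ _ => mul_nonneg (mul_nonneg (by positivity) (sq_nonneg _)) (Z.cell σ).edgeCoeff_det_pos.le
  have hz := (Finset.sum_eq_zero_iff_of_nonneg hnn).1 hsum σ₀ (Finset.mem_univ _)
  have hw : (0 : ℝ) < (Z.cell σ₀).weight := by exact_mod_cast (Z.cell σ₀).weight_pos
  have hpl : (0 : ℝ) < (pluckerCoord (Z.cell σ₀).frame S₀ : ℝ) ^ 2 := by
    have : (pluckerCoord (Z.cell σ₀).frame S₀ : ℝ) ≠ 0 := by exact_mod_cast hS₀
    positivity
  have := mul_pos (mul_pos hw hpl) (Z.cell σ₀).edgeCoeff_det_pos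
  linarith

end Summit.HodgeConjecture.HodgeConjecture.Theorems.TropicalWeilVanishing

end
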